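import Summits.CriticalPhenomena.PercolationContinuityZ3.Theorems.PercNearOneGluingNoHeavyLowerTailTopPacking
import Summits.CriticalPhenomena.PercolationContinuityZ3.Theorems.PercNearOneGluingNoHeavyLowerTailSharpTCSReduction
import HarnessLib

/-!
# `NoHeavyLowerTail` (stmt-CriticalPhenomena-4575) — the T-FORM TOP PACKING `TTP_j` (apex of the lemma-factory-8 lattice)
# implies STCS2, hence closes the crux (typed reduction)

Support file (lemma factory #8 `prim-lf-8`, gen 4, batch 6; `--supports stmt-CriticalPhenomena-4575`).  No definitions,
no named facts, no sorries.  Vocabulary of `…TopPacking.lean`: `μ = prodBernoulli w` on `Fin n`, relays `A`, observer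
`o ∉ A`, level `j`, `R_x = {|π(x)| ≤ j}`, `S(x) = μ(R_x)`, `L = {1 ≤ N ≤ j}`, a ranking `rk` injective on `A` along which `S`
is non-increasing, `W_x = L ∩ {o ↔ x} ∩ {∀ y ∈ A, rk y < rk x → o ↮ y}` ("top(π(o)) = x").

**TTP_j** (CANDIDATES.md v6, B6-1): for a champion `c` ranked FIRST (`rk c < rk y` for `y ∈ A ∖ c`),

  `Σ_{x ∈ A} μ(W_x)/S(x) ≤ μ({1 ≤ N} ∩ R_c)/S(c)`      ("Σ_x P(top = x, small | x light) ≤ P(attached | champion light)").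

It implies the unguarded top packing TP (right side `≤ 1`) and — splitting off the `x = c` term `μ(L ∩ {o ↔ c})/S(c)` on
both sides and bounding `S(x) ≤ t` for `x ≠ c` — the sharpened guarded Cauchy–Schwarz law STCS2 in the binder form of
`Theorems.noHeavyLowerTail_of_sharpTCS`:  `μ({o ↮ c} ∩ L)·S(c) ≤ μ({o ↮ c} ∩ {1 ≤ N} ∩ R_c)·t`.  Status of TTP: alive at the
champion (seat screens 7 239 cases + 360 scale-free climbs, 0 violations; ttrl2 request `lf8-b6-ttp`); level `j = 1` is a
theorem for EVERY relay `c` (chain of `…SharpTCSOne.lean`); the any-relay form is FALSE from `j = 2` (exact witnesses,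
`run/shared/lean/prim/prim-lf-8/witnesses-gen4/`); hub calibration: TTP ⇒ TP(Ω) = PBCR(A), Conj-1-hard.

* `TformTopPacking.sharpTCS_of_tformTopPacking` — one instance: TTP at `(w, A, o, c, j)` for the `c`-first canonical ranking
  ⇒ the STCS2 inequality at `(w, A, o, c, j, t)` for every admissible runner-up bound `t`;
* `noHeavyLowerTail_of_tformTopPacking` — **TTP (all graphs, champions ranked first) ⇒ `NoHeavyLowerTail`**.
-/

noncomputable section

namespace Summit.CriticalPhenomena.PercolationContinuityZ3.Theorems

open MeasureTheory Set Literature.Probability.LatticeModels Literature.Probability.Percolation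
open scoped Classical BigOperators

variable {n : ℕ}

namespace TformTopPacking

open TopPacking GuardedTopPacking

/-- The `c`-first perturbed score: `S` with `+1` at `c`.  Ranking by it puts `c` first and is `S`-antitone when `c` is a
champion. [this file] -/
theorem rank_first (A : Finset (Fin n)) (S : Fin n → ℝ) (c : Fin n) (hc : c ∈ A)
    (hchamp : ∀ a ∈ A, S a ≤ S c) {y : Fin n} (hy : y ∈ A) (hyc : y ≠ c) :
    (A.filter fun z => (fun x => if x = c then S x + 1 else S x) c <
        (fun x => if x = c then S x + 1 else S x) z ∨
        ((fun x => if x = c then S x + 1 else S x) z = (fun x => if x = c then S x + 1 else S x) c ∧ z < c)).card <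
      (A.filter fun z => (fun x => if x = c then S x + 1 else S x) y <
        (fun x => if x = c then S x + 1 else S x) z ∨
        ((fun x => if x = c then S x + 1 else S x) z = (fun x => if x = c then S x + 1 else S x) y ∧ z < y)).card := by
  refine rank_lt_of_before A (fun x => if x = c then S x + 1 else S x) hc (Or.inl ?_)
  simp only [hyc, if_false, if_true]
  linarith [hchamp y hy]

/-- The perturbed ranking is `S`-antitone on `A` when `c` is a champion. [this file] -/
theorem rank_first_antitone (A : Finset (Fin n)) (S : Fin n → ℝ) (c : Fin n)
    (hchamp : ∀ a ∈ A, S a ≤ S c) {x y : Fin n} (hx : x ∈ A) (hy : y ∈ A)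
    (h : (A.filter fun z => (fun x => if x = c then S x + 1 else S x) x <
        (fun x => if x = c then S x + 1 else S x) z ∨
        ((fun x => if x = c then S x + 1 else S x) z = (fun x => if x = c then S x + 1 else S x) x ∧ z < x)).card <
      (A.filter fun z => (fun x => if x = c then S x + 1 else S x) y <
        (fun x => if x = c then S x + 1 else S x) z ∨
        ((fun x => if x = c then S x + 1 else S x) z = (fun x => if x = c then S x + 1 else S x) y ∧ z < y)).card) :
    S y ≤ S x := by
  have key := rank_antitone A (fun x => if x = c then S x + 1 else S x) hx hy h
  by_cases hxc : x = c
  · rw [hxc]; exact hchamp y hy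
  · by_cases hyc : y = c
    · subst hyc
      simp only [hxc, if_false, if_true] at key
      linarith [hchamp x hx]
    · simpa only [hxc, hyc, if_false] using key

/-- **TTP ⇒ STCS2 at one instance.**  Let `c ∈ A` be a champion (`S(a) ≤ S(c)` for `a ∈ A`), `rk` the `c`-first canonical
ranking, and suppose the T-form top packing `Σ_{x∈A} μ(W_x)/S(x) ≤ μ({1 ≤ N} ∩ R_c)/S(c)`.  Then for every `t ≥ 0` with
`S(a) ≤ t` for `a ≠ c`:  `μ({o ↮ c} ∩ L)·S(c) ≤ μ({o ↮ c} ∩ {1 ≤ N ∧ |π(c)| ≤ j})·t`. [this file] -/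
theorem sharpTCS_of_tformTopPacking (w : Sym2 (Fin n) → unitInterval) (A : Finset (Fin n)) (o c : Fin n) (j : ℕ)
    (t : ℝ) (hc : c ∈ A) (ht : 0 ≤ t)
    (hdom : ∀ a ∈ A, a ≠ c →
      (prodBernoulli w).real {ω : BondConfig (Fin n) | (A.filter fun x => ω ∈ openConn a x).card ≤ j} ≤ t)
    (htc : t ≤ (prodBernoulli w).real {ω : BondConfig (Fin n) | (A.filter fun x => ω ∈ openConn c x).card ≤ j})
    (hTTP : let S : Fin n → ℝ := fun x =>
        (prodBernoulli w).real {ω : BondConfig (Fin n) | (A.filter fun z => ω ∈ openConn x z).card ≤ j}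
      let rk : Fin n → ℕ := fun x => (A.filter fun z => (fun x => if x = c then S x + 1 else S x) x <
        (fun x => if x = c then S x + 1 else S x) z ∨
        ((fun x => if x = c then S x + 1 else S x) z = (fun x => if x = c then S x + 1 else S x) x ∧ z < x)).card
      ∑ x ∈ A, (prodBernoulli w).real
          ({ω : BondConfig (Fin n) | 1 ≤ (A.filter fun z => ω ∈ openConn o z).card ∧
              (A.filter fun z => ω ∈ openConn o z).card ≤ j} ∩
            {ω | ω ∈ openConn o x} ∩ {ω | ∀ y ∈ A, rk y < rk x → ω ∉ openConn o y}) / S x ≤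
        (prodBernoulli w).real ({ω : BondConfig (Fin n) | 1 ≤ (A.filter fun z => ω ∈ openConn o z).card} ∩
          {ω | (A.filter fun z => ω ∈ openConn c z).card ≤ j}) / S c) :
    (prodBernoulli w).real ((openConn o c : Set (BondConfig (Fin n)))ᶜ ∩
          {ω | 1 ≤ (A.filter fun x => ω ∈ openConn o x).card ∧
            (A.filter fun x => ω ∈ openConn o x).card ≤ j}) *
        (prodBernoulli w).real {ω : BondConfig (Fin n) | (A.filter fun x => ω ∈ openConn c x).card ≤ j} ≤
      (prodBernoulli w).real ((openConn o c : Set (BondConfig (Fin n)))ᶜ ∩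
          {ω | 1 ≤ (A.filter fun x => ω ∈ openConn o x).card ∧
            (A.filter fun x => ω ∈ openConn c x).card ≤ j}) * t := by
  set μ := prodBernoulli w with hμ
  set S : Fin n → ℝ := fun x => μ.real {ω : BondConfig (Fin n) | (A.filter fun z => ω ∈ openConn x z).card ≤ j}
    with hS
  set Φ' : Fin n → ℝ := fun x => if x = c then S x + 1 else S x with hΦ'
  set rk : Fin n → ℕ := fun x => (A.filter fun z => Φ' x < Φ' z ∨ (Φ' z = Φ' x ∧ z < x)).card with hrk
  set Lev : Set (BondConfig (Fin n)) := {ω | 1 ≤ (A.filter fun z => ω ∈ openConn o z).card ∧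
      (A.filter fun z => ω ∈ openConn o z).card ≤ j} with hLev
  set W : Fin n → Set (BondConfig (Fin n)) := fun x =>
    Lev ∩ {ω | ω ∈ openConn o x} ∩ {ω | ∀ y ∈ A, rk y < rk x → ω ∉ openConn o y} with hW
  set Vc : Set (BondConfig (Fin n)) := {ω : BondConfig (Fin n) | 1 ≤ (A.filter fun z => ω ∈ openConn o z).card} ∩
      {ω | (A.filter fun z => ω ∈ openConn c z).card ≤ j} with hVc
  have hmeas : ∀ s : Set (BondConfig (Fin n)), MeasurableSet s := fun _ => MeasurableSet.of_discrete
  have hchamp : ∀ a ∈ A, S a ≤ S c := by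
    intro a ha
    by_cases hac : a = c
    · rw [hac]
    · exact (hdom a ha hac).trans htc
  have hpack : ∑ x ∈ A, μ.real (W x) / S x ≤ μ.real Vc / S c := hTTP
  -- ranking facts
  have hinj : Set.InjOn rk ↑A := rank_injOn A Φ'
  have hfirst : ∀ y ∈ A, ¬ rk y < rk c := by
    intro y hy hlt
    by_cases hyc : y = c
    · rw [hyc] at hlt; exact lt_irrefl _ hlt
    · exact absurd hlt (not_lt.2 (le_of_lt (rank_first A S c hc hchamp hy hyc)))
  -- (1) partition by the top relay
  have hsum : μ.real Lev = ∑ x ∈ A, μ.real (W x) := real_L_eq_sum w A o j rk hinj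
  -- (2) the champion's term: `W_c = L ∩ {o ↔ c} = Vc ∩ {o ↔ c}`
  have hWc : W c = Lev ∩ openConn o c := by
    ext ω
    simp only [hW, mem_inter_iff, mem_setOf_eq]
    constructor
    · rintro ⟨⟨hL, hoc⟩, -⟩; exact ⟨hL, hoc⟩
    · rintro ⟨hL, hoc⟩; exact ⟨⟨hL, hoc⟩, fun y hy hlt _ => hfirst y hy hlt⟩
  have hLc : Lev ∩ openConn o c = Vc ∩ openConn o c := by
    ext ω
    simp only [hLev, hVc, mem_inter_iff, mem_setOf_eq]
    constructor
    · rintro ⟨⟨h1, hle⟩, hoc⟩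
      refine ⟨⟨h1, ?_⟩, hoc⟩
      rw [GuardedCIL.filter_eq_of_reachable A hoc]; exact hle
    · rintro ⟨⟨h1, hle⟩, hoc⟩
      refine ⟨⟨h1, ?_⟩, hoc⟩
      rw [← GuardedCIL.filter_eq_of_reachable A hoc]; exact hle
  -- (3) complements
  have hLsplit : μ.real ((openConn o c : Set (BondConfig (Fin n)))ᶜ ∩ Lev) = μ.real Lev - μ.real (W c) := by
    have := measureReal_inter_add_sdiff (μ := μ) (s := Lev) (hmeas (openConn o c))
    rw [Set.sdiff_eq, Set.inter_comm Lev (openConn o c)ᶜ] at this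
    rw [hWc]; linarith
  have hVsplit : μ.real ((openConn o c : Set (BondConfig (Fin n)))ᶜ ∩ Vc) = μ.real Vc - μ.real (W c) := by
    have := measureReal_inter_add_sdiff (μ := μ) (s := Vc) (hmeas (openConn o c))
    rw [Set.sdiff_eq, Set.inter_comm Vc (openConn o c)ᶜ] at this
    rw [hWc, hLc]; linarith
  -- (4) the non-champion terms: `μ(W_x) ≤ t · (μ(W_x)/S x)`
  have hterm : ∀ x ∈ A.erase c, μ.real (W x) ≤ t * (μ.real (W x) / S x) := by
    intro x hx
    obtain ⟨hxc, hxA⟩ := Finset.mem_erase.1 hx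
    have hWle : μ.real (W x) ≤ S x := measureReal_mono (W_subset_R A o x j rk) (measure_ne_top _ _)
    have hS0 : 0 ≤ S x := measureReal_nonneg
    rcases eq_or_lt_of_le hS0 with h0 | hpos
    · have hW0 : μ.real (W x) = 0 := le_antisymm (h0 ▸ hWle) measureReal_nonneg
      rw [hW0]; simp
    · calc μ.real (W x) = S x * (μ.real (W x) / S x) := by field_simp
        _ ≤ t * (μ.real (W x) / S x) :=
          mul_le_mul_of_nonneg_right (hdom x hxA hxc) (div_nonneg measureReal_nonneg hS0)
  have hrest : ∑ x ∈ A.erase c, μ.real (W x) ≤ t * ∑ x ∈ A.erase c, μ.real (W x) / S x := by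
    rw [Finset.mul_sum]; exact Finset.sum_le_sum hterm
  -- (5) the case `S c = 0` is trivial (`t = 0`)
  have hSc0 : 0 ≤ S c := measureReal_nonneg
  rcases eq_or_lt_of_le hSc0 with hS0 | hSpos
  · have ht0 : t = 0 := le_antisymm (hS0 ▸ htc) ht
    have : μ.real ((openConn o c : Set (BondConfig (Fin n)))ᶜ ∩ Lev) * S c = 0 := by rw [← hS0, mul_zero]
    rw [ht0, mul_zero]
    exact le_of_eq this
  -- (6) assemble
  have hsumsplit : ∑ x ∈ A.erase c, μ.real (W x) / S x = ∑ x ∈ A, μ.real (W x) / S x - μ.real (W c) / S c := by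
    rw [← Finset.add_sum_erase A _ hc]; ring
  have hLsum : μ.real Lev - μ.real (W c) = ∑ x ∈ A.erase c, μ.real (W x) := by
    rw [hsum, ← Finset.add_sum_erase A _ hc]; ring
  have key : (μ.real Lev - μ.real (W c)) * S c ≤ t * (μ.real Vc - μ.real (W c)) := by
    calc (μ.real Lev - μ.real (W c)) * S c
        = (∑ x ∈ A.erase c, μ.real (W x)) * S c := by rw [hLsum]
      _ ≤ (t * ∑ x ∈ A.erase c, μ.real (W x) / S x) * S c := mul_le_mul_of_nonneg_right hrest hSc0
      _ = t * ((∑ x ∈ A, μ.real (W x) / S x - μ.real (W c) / S c) * S c) := by rw [hsumsplit]; ring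
      _ ≤ t * ((μ.real Vc / S c - μ.real (W c) / S c) * S c) := by
          apply mul_le_mul_of_nonneg_left _ ht
          exact mul_le_mul_of_nonneg_right (by linarith [hpack]) hSc0
      _ = t * (μ.real Vc - μ.real (W c)) := by field_simp
  have hset : ((openConn o c : Set (BondConfig (Fin n)))ᶜ ∩
      {ω | 1 ≤ (A.filter fun x => ω ∈ openConn o x).card ∧ (A.filter fun x => ω ∈ openConn c x).card ≤ j}) =
      (openConn o c)ᶜ ∩ Vc := by
    ext ω; simp only [hVc, mem_inter_iff, mem_setOf_eq]
  rw [hLsplit, hset, hVsplit]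
  calc (μ.real Lev - μ.real (W c)) * μ.real {ω : BondConfig (Fin n) | (A.filter fun x => ω ∈ openConn c x).card ≤ j}
      = (μ.real Lev - μ.real (W c)) * S c := rfl
    _ ≤ t * (μ.real Vc - μ.real (W c)) := key
    _ = (μ.real Vc - μ.real (W c)) * t := mul_comm _ _

end TformTopPacking

open TformTopPacking in
/-- **The T-form top packing closes the crux.**  If for every weighted graph on `Fin n`, every relay set `A`, observer
`o ∉ A`, level `j` and champion `c ∈ A` (with the `c`-first canonical ranking `rk`) the T-form top packing
`Σ_{x∈A} μ(W_x)/S(x) ≤ μ({1 ≤ N} ∩ R_c)/S(c)` holds, then `NoHeavyLowerTail`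
(via `sharpTCS_of_tformTopPacking` and `noHeavyLowerTail_of_sharpTCS`: TTP ⇒ STCS2 ⇒ QP ⇒ QG ⇒ CIL ⇒ crux). -/
theorem noHeavyLowerTail_of_tformTopPacking
    (hTTP : ∀ (n : ℕ) (w : Sym2 (Fin n) → unitInterval) (A : Finset (Fin n)) (o c : Fin n) (j : ℕ),
      o ∉ A → c ∈ A →
      (∀ a ∈ A, (prodBernoulli w).real {ω : BondConfig (Fin n) | (A.filter fun x => ω ∈ openConn a x).card ≤ j} ≤
        (prodBernoulli w).real {ω : BondConfig (Fin n) | (A.filter fun x => ω ∈ openConn c x).card ≤ j}) →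
      let S : Fin n → ℝ := fun x =>
        (prodBernoulli w).real {ω : BondConfig (Fin n) | (A.filter fun z => ω ∈ openConn x z).card ≤ j}
      let rk : Fin n → ℕ := fun x => (A.filter fun z => (fun x => if x = c then S x + 1 else S x) x <
        (fun x => if x = c then S x + 1 else S x) z ∨
        ((fun x => if x = c then S x + 1 else S x) z = (fun x => if x = c then S x + 1 else S x) x ∧ z < x)).card
      ∑ x ∈ A, (prodBernoulli w).real
          ({ω : BondConfig (Fin n) | 1 ≤ (A.filter fun z => ω ∈ openConn o z).card ∧
              (A.filter fun z => ω ∈ openConn o z).card ≤ j} ∩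
            {ω | ω ∈ openConn o x} ∩ {ω | ∀ y ∈ A, rk y < rk x → ω ∉ openConn o y}) / S x ≤
        (prodBernoulli w).real ({ω : BondConfig (Fin n) | 1 ≤ (A.filter fun z => ω ∈ openConn o z).card} ∩
          {ω | (A.filter fun z => ω ∈ openConn c z).card ≤ j}) / S c) :
    Summit.CriticalPhenomena.PercolationContinuityZ3.Theses.PercNearOneGluing.NoHeavyLowerTail := by
  refine noHeavyLowerTail_of_sharpTCS fun n w A o c j t ho hc ht hdom htc => ?_
  have hchamp : ∀ a ∈ A,
      (prodBernoulli w).real {ω : BondConfig (Fin n) | (A.filter fun x => ω ∈ openConn a x).card ≤ j} ≤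
        (prodBernoulli w).real {ω : BondConfig (Fin n) | (A.filter fun x => ω ∈ openConn c x).card ≤ j} := by
    intro a ha
    by_cases hac : a = c
    · rw [hac]
    · exact (hdom a ha hac).trans htc
  exact sharpTCS_of_tformTopPacking w A o c j t hc ht hdom htc (hTTP n w A o c j ho hc hchamp)

end Summit.CriticalPhenomena.PercolationContinuityZ3.Theorems

end
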